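import Mathlib
import Literature.Geometry.DiscreteGeometry.KissingPatterns
import Literature.MathematicalPhysics.StatisticalMechanics.Crystallization
import Literature.MathematicalPhysics.StatisticalMechanics.PeriodicConfigurationSums
import Literature.MathematicalPhysics.StatisticalMechanics.LennardJonesClusters
import Literature.Barriers.AtomisticToContinuum.SutoDegenerateGroundStates

/-!
# Route ReggeStarCoercivity — crux `StarCoercivity` (item `stmt-AtomisticToContinuum-13600`),
# line `elastic-tier-overlap-split`: stub `stub_coarseTierTransfer` (S3t, transfer torus → finite)

The far (coarse, tolerance `1/15`) tier of the line is split into a statement ON THE TORUS (S3p,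
`stub_coarseTierPeriodic`: for every periodic configuration `P` of `ℝ³` whose point set is
`1/3`-separated, `e_per + g₁ · #(1/15-gross motif points)/#motif ≤ e(P)`, shells read in
`P.points`) and the present TRANSFER S3t: S3p implies the far tier for FINITE `1/3`-separated
configurations `x : Fin N → ℝ³` with boundary constant `C = 0`:
`N · e_per + g₁ · #Def₁⁄₁₅(x) ≤ E_LJ(x)`.

PROOF (periodisation).  For `N ≥ 1` take ANY periodic configuration `P` with motif
`univ.image x` all of whose non-zero periods have length `≥ L = 2Σ‖xᵢ‖ + 2`
(`exists_periodicConfiguration`: the cubic lattice `Lℤ³`,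
`Literature.Barriers.AtomisticToContinuum.cubicLattice`, whose non-zero vectors have norm `≥ L`
by `le_norm_of_mem_cubicLattice_mk0`).  Then: points of `P` other than the `xⱼ` are at distance
`≥ 2` from every `xᵢ` (`two_le_dist_of_mem_points`); `P.points` is `1/3`-separated when `x` is
(`separated_points`); the shells read in `P.points` within radius `6/5` are the shells of `x`
(`toFinset_inter_points_image`, tolerance-agnostic), so the `1/15`-gross motif count is the
`1/15`-gross index count (`card_gross_motif`) and `#motif = N`; and `e(P) ≤ E_LJ(x)/N`
(`energyPerParticle_le`: the cross terms of the summable lattice sum are `V_LJ(r) ≤ 0`, `r ≥ 2`;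
`sum_le_hasSum`).  Feed `P` to the hypothesis and multiply by `N`; `N = 0` is trivial.
Adapted from `Cruxes/StarCoercivity/Disproof.lean` §5/§9
(refuter-cdisprove-stmt-AtomisticToContinuum-13600 g2/g3).  Imports: Mathlib + Literature only;
no named fact, no new definition (the periodisation is an existence theorem).
-/

noncomputable section

open scoped BigOperators Classical

namespace Summit.AtomisticToContinuum.Crystallization.Theorems

open Literature.MathematicalPhysics.StatisticalMechanics Literature.Geometry.DiscreteGeometry

namespace CoarseTierTransfer

open Literature.Barriers.AtomisticToContinuum (cubicLattice cubicBasis cubicBasis_apply)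

-- adapted from Cruxes/StarCoercivity/Disproof.lean §5/§9 (refuter-cdisprove-stmt-AtomisticToContinuum-13600 g2/g3)

variable {N : ℕ} {x : Fin N → EuclideanSpace ℝ (Fin 3)}

/-! ## The cubic lattice `cℤ³`: non-zero vectors have norm `≥ c` -/

/-- Non-zero vectors of the cubic lattice `Lℤ³` (`L > 0`, as the unit `Units.mk0 L _`) have norm `≥ L`:
some coordinate is a non-zero integer multiple of `L` (coordinates of `cubicLattice` vectors are integer
multiples of `L`, by `Submodule.span_induction` over the cubic basis). [folklore] -/
theorem le_norm_of_mem_cubicLattice_mk0 {L : ℝ} (hL : 0 < L) {v : EuclideanSpace ℝ (Fin 3)}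
    (hv : v ∈ cubicLattice (Units.mk0 L hL.ne')) (hv0 : v ≠ 0) : L ≤ ‖v‖ := by
  -- integer coordinates
  have hcoordZ : ∀ j : Fin 3, ∃ n : ℤ, v j = L * n := by
    clear hv0
    intro j
    induction hv using Submodule.span_induction generalizing j with
    | mem v hv =>
      obtain ⟨i, rfl⟩ := hv
      rw [cubicBasis_apply]
      by_cases hji : j = i
      · subst hji; exact ⟨1, by simp⟩
      · exact ⟨0, by simp [hji]⟩
    | zero => exact ⟨0, by simp⟩
    | add u w _ _ hu hw =>
      obtain ⟨n, hn⟩ := hu j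
      obtain ⟨m, hm⟩ := hw j
      exact ⟨n + m, by simp [hn, hm, mul_add]⟩
    | smul a u _ hu =>
      obtain ⟨n, hn⟩ := hu j
      exact ⟨a * n, by simp [hn]; ring⟩
  have hex : ∃ j, v j ≠ 0 := by
    by_contra hall
    push Not at hall
    exact hv0 (PiLp.ext fun j => by simpa using hall j)
  obtain ⟨j, hj⟩ := hex
  obtain ⟨n, hn⟩ := hcoordZ j
  have hn0 : n ≠ 0 := by
    rintro rfl
    simp at hn
    exact hj hn
  have hn1 : (1 : ℝ) ≤ |(n : ℝ)| := by
    rw [← Int.cast_abs]; exact_mod_cast Int.one_le_abs hn0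
  have hcoord : |v j| ≤ ‖v‖ := by
    have := PiLp.norm_apply_le v j
    simpa using this
  calc L ≤ L * |(n : ℝ)| := le_mul_of_one_le_right hL.le hn1
    _ = |v j| := by rw [hn, abs_mul, abs_of_pos hL]
    _ ≤ ‖v‖ := hcoord

/-! ## A periodic configuration with motif `{xᵢ}` and long periods -/

/-- All mutual distances of `x` are at most `2Σ‖x k‖`. [folklore] -/
theorem norm_sub_le_two_sum (x : Fin N → EuclideanSpace ℝ (Fin 3)) (i j : Fin N) :
    ‖x i - x j‖ ≤ 2 * ∑ k, ‖x k‖ := by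
  have hi : ‖x i‖ ≤ ∑ k, ‖x k‖ :=
    Finset.single_le_sum (f := fun k => ‖x k‖) (fun _ _ => norm_nonneg _) (Finset.mem_univ i)
  have hj : ‖x j‖ ≤ ∑ k, ‖x k‖ :=
    Finset.single_le_sum (f := fun k => ‖x k‖) (fun _ _ => norm_nonneg _) (Finset.mem_univ j)
  linarith [norm_sub_le (x i) (x j)]

/-- **Periodisation exists.**  For `N ≥ 1` there is a periodic configuration of `ℝ³` with motif
`{xᵢ}` all of whose non-zero periods have length `≥ L = 2Σ‖xᵢ‖ + 2`: take the cubic lattice `Lℤ³`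
(distinct motif points differ by less than `L`, so they are inequivalent modulo it). [folklore] -/
theorem exists_periodicConfiguration (x : Fin N → EuclideanSpace ℝ (Fin 3)) (hN : 0 < N) :
    ∃ P : PeriodicConfiguration 3, P.motif = Finset.univ.image x ∧
      ∀ g ∈ P.lattice, g ≠ 0 → 2 * ∑ k, ‖x k‖ + 2 ≤ ‖g‖ := by
  have hS : 0 ≤ ∑ k, ‖x k‖ := Finset.sum_nonneg fun _ _ => norm_nonneg _
  have hL : 0 < 2 * ∑ k, ‖x k‖ + 2 := by linarith
  have hlat : ∀ g ∈ cubicLattice (Units.mk0 _ hL.ne'), g ≠ 0 → 2 * ∑ k, ‖x k‖ + 2 ≤ ‖g‖ :=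
    fun g hg hg0 => le_norm_of_mem_cubicLattice_mk0 hL hg hg0
  refine ⟨{ lattice := cubicLattice (Units.mk0 _ hL.ne')
            discrete := inferInstance
            isZLattice := inferInstance
            motif := Finset.univ.image x
            motif_nonempty := ?_
            eq_of_sub_mem := ?_ }, rfl, hlat⟩
  · haveI : Nonempty (Fin N) := ⟨⟨0, hN⟩⟩
    exact Finset.univ_nonempty.image x
  · intro p hp q hq hpq
    obtain ⟨i, -, rfl⟩ := Finset.mem_image.1 hp
    obtain ⟨j, -, rfl⟩ := Finset.mem_image.1 hq
    by_contra hne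
    have h1 := hlat _ hpq (sub_ne_zero.2 hne)
    have h2 := norm_sub_le_two_sum x i j
    linarith

/-! ## Consequences for any such configuration -/

section Consequences

variable {P : PeriodicConfiguration 3}

/-- Points of `P` other than the `xⱼ` are at distance `≥ 2` from every `xᵢ` (a non-zero period
has length `≥ 2Σ‖xᵢ‖ + 2`); in particular they never enter a `6/5`-shell. [folklore] -/
theorem two_le_dist_of_mem_points (hPm : P.motif = Finset.univ.image x)
    (hPl : ∀ g ∈ P.lattice, g ≠ 0 → 2 * ∑ k, ‖x k‖ + 2 ≤ ‖g‖) (i : Fin N)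
    {y : EuclideanSpace ℝ (Fin 3)} (hy : y ∈ P.points) (hyx : ∀ j, y ≠ x j) :
    2 ≤ dist (x i) y := by
  obtain ⟨z, hz, g, hg, rfl⟩ := hy
  rw [hPm] at hz
  obtain ⟨j, -, rfl⟩ := Finset.mem_image.1 hz
  have hg0 : g ≠ 0 := by
    rintro rfl
    exact hyx j (by simp)
  have hL := hPl g hg hg0
  rw [dist_eq_norm]
  have h1 : ‖g‖ - ‖x i - x j‖ ≤ ‖x i - (x j + g)‖ := by
    rw [show x i - (x j + g) = (x i - x j) - g by abel, ← norm_neg ((x i - x j) - g), neg_sub]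
    exact norm_sub_norm_le g (x i - x j)
  have h2 := norm_sub_le_two_sum x i j
  linarith

/-- **`P.points` is `1/3`-separated when `x` is.**  Two distinct points `xᵢ + g` and `v`: after
translating by the period `−g`, either `v − g = xⱼ` with `j ≠ i` (distance `dist xᵢ xⱼ ≥ 1/3`),
or `v − g` is not a motif point and lies at distance `≥ 2` from `xᵢ`. [folklore] -/
theorem separated_points (hPm : P.motif = Finset.univ.image x)
    (hPl : ∀ g ∈ P.lattice, g ≠ 0 → 2 * ∑ k, ‖x k‖ + 2 ≤ ‖g‖)
    (hsep : ∀ i j : Fin N, i ≠ j → (1 / 3 : ℝ) ≤ dist (x i) (x j)) :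
    ∀ u ∈ P.points, ∀ v ∈ P.points, u ≠ v → (1 / 3 : ℝ) ≤ dist u v := by
  rintro u ⟨z, hz, g, hg, rfl⟩ v hv huv
  rw [hPm] at hz
  obtain ⟨i, -, rfl⟩ := Finset.mem_image.1 hz
  have hv' : v - g ∈ P.points := by
    have h := P.add_mem_points hv (P.lattice.neg_mem hg)
    simpa [sub_eq_add_neg] using h
  have hdist : dist (x i + g) v = dist (x i) (v - g) := by
    rw [dist_eq_norm, dist_eq_norm]
    congr 1
    abel
  rw [hdist]
  by_cases h : ∃ j, v - g = x j
  · obtain ⟨j, hj⟩ := h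
    rw [hj]
    refine hsep i j ?_
    rintro rfl
    exact huv (sub_eq_iff_eq_add.1 hj).symm
  · push Not at h
    have h2 := two_le_dist_of_mem_points hPm hPl i hv' h
    linarith

/-- **Shells read in `P.points` are the shells of `x`.**  The points of `P` in the punctured
`6/5`-ball about `xᵢ`, recentred at `xᵢ` and rescaled by `a⁻¹`, form exactly the recentred
rescaled `6/5`-shell of the index `i` in `x` (`x` injective; any finiteness witness). [folklore] -/
theorem toFinset_inter_points_image (hPm : P.motif = Finset.univ.image x)
    (hPl : ∀ g ∈ P.lattice, g ≠ 0 → 2 * ∑ k, ‖x k‖ + 2 ≤ ‖g‖) (hx : Function.Injective x)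
    (i : Fin N) (a : ℝ)
    (hfin : ((Metric.closedBall (x i) (6 / 5) \ {x i}) ∩ P.points).Finite) :
    (hfin.toFinset.image fun y => a⁻¹ • (y - x i)) =
      (Finset.univ.filter fun j : Fin N => j ≠ i ∧ dist (x i) (x j) ≤ 6 / 5).image
        fun j => a⁻¹ • (x j - x i) := by
  ext v
  simp only [Finset.mem_image, Set.Finite.mem_toFinset, Set.mem_inter_iff,
    Metric.mem_closedBall, Set.mem_singleton_iff, Finset.mem_filter, Finset.mem_univ,
    true_and, Set.mem_sdiff]
  constructor
  · rintro ⟨y, ⟨⟨hyb, hys⟩, hyP⟩, rfl⟩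
    have hex : ∃ j, y = x j := by
      by_contra hno
      push Not at hno
      have h2 := two_le_dist_of_mem_points hPm hPl i hyP hno
      rw [dist_comm] at hyb
      linarith
    obtain ⟨j, rfl⟩ := hex
    exact ⟨j, ⟨fun hji => hys (by rw [hji]), by rwa [dist_comm] at hyb⟩, rfl⟩
  · rintro ⟨j, ⟨hji, hd⟩, rfl⟩
    refine ⟨x j, ⟨⟨by rwa [dist_comm], fun h => hji (hx h)⟩, ?_⟩, rfl⟩
    exact P.mem_points_of_mem_motif (by
      rw [hPm]; exact Finset.mem_image_of_mem x (Finset.mem_univ j))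

/-- **The gross motif points of `P` are the gross indices of `x`** (any tolerance `θ`): the motif
points `s` whose `6/5`-shell read in `P.points` is not `θ`-close (after an admissible dilation
`a ∈ [9/10, 11/10]`) to the fcc or the hcp kissing pattern are counted by the indices `i` whose
`6/5`-shell in `x` is not `θ`-close to them (`toFinset_inter_points_image`). [folklore] -/
theorem card_gross_motif (hPm : P.motif = Finset.univ.image x)
    (hPl : ∀ g ∈ P.lattice, g ≠ 0 → 2 * ∑ k, ‖x k‖ + 2 ≤ ‖g‖) (hx : Function.Injective x)
    (θ : ℝ) :
    (P.motif.filter fun s => ¬ ∃ a : ℝ, 9 / 10 ≤ a ∧ a ≤ 11 / 10 ∧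
        (ShellCloseTo θ
            ((P.finite_inter_points (Metric.isBounded_closedBall.subset Set.sdiff_subset :
              Bornology.IsBounded (Metric.closedBall s (6 / 5) \ {s}))).toFinset.image
                fun y => a⁻¹ • (y - s)) fccKissingPattern ∨
          ShellCloseTo θ
            ((P.finite_inter_points (Metric.isBounded_closedBall.subset Set.sdiff_subset :
              Bornology.IsBounded (Metric.closedBall s (6 / 5) \ {s}))).toFinset.image
                fun y => a⁻¹ • (y - s)) hcpKissingPattern)).card =
      Nat.card {i : Fin N // ¬ ∃ a : ℝ, 9 / 10 ≤ a ∧ a ≤ 11 / 10 ∧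
        (ShellCloseTo θ ((Finset.univ.filter fun j : Fin N => j ≠ i ∧ dist (x i) (x j) ≤ 6 / 5).image
            fun j => a⁻¹ • (x j - x i)) fccKissingPattern ∨
          ShellCloseTo θ ((Finset.univ.filter fun j : Fin N => j ≠ i ∧ dist (x i) (x j) ≤ 6 / 5).image
            fun j => a⁻¹ • (x j - x i)) hcpKissingPattern)} := by
  rw [hPm, Finset.filter_image, Finset.card_image_of_injective _ hx, Nat.card_eq_fintype_card,
    Fintype.card_subtype]
  congr 1
  refine Finset.filter_congr fun i _ => ?_
  have hPm' : P.motif = Finset.univ.image x := hPm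
  simp only [toFinset_inter_points_image hPm' hPl hx i]

/-- The lattice sum at `xᵢ` over `P.points` is at most the finite site energy
`∑_{k ≠ i} V_LJ(|xᵢ − x_k|)`: the remaining terms are `V_LJ(r) ≤ 0`, `r ≥ 2`
(`sum_le_hasSum` on the negated summable lattice sum). [folklore] -/
theorem tsum_le_siteEnergy (hPm : P.motif = Finset.univ.image x)
    (hPl : ∀ g ∈ P.lattice, g ≠ 0 → 2 * ∑ k, ‖x k‖ + 2 ≤ ‖g‖) (hx : Function.Injective x)
    (i : Fin N) :
    (∑' y : {y : EuclideanSpace ℝ (Fin 3) // y ∈ P.points ∧ y ≠ x i},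
        lennardJones (dist (x i) y.1)) ≤ siteEnergy lennardJones x i := by
  set f : {y : EuclideanSpace ℝ (Fin 3) // y ∈ P.points ∧ y ≠ x i} → ℝ :=
    fun y => lennardJones (dist (x i) y.1) with hf
  have hsum : Summable f := P.summable_lennardJones_dist_three (x i)
  have hmem : ∀ k : {k // k ∈ Finset.univ.erase i}, x k.1 ∈ P.points ∧ x k.1 ≠ x i := fun k =>
    ⟨P.mem_points_of_mem_motif (by
        rw [hPm]; exact Finset.mem_image_of_mem x (Finset.mem_univ _)),
      hx.ne (Finset.ne_of_mem_erase k.2)⟩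
  set emb : {k // k ∈ Finset.univ.erase i} → {y : EuclideanSpace ℝ (Fin 3) // y ∈ P.points ∧ y ≠ x i} :=
    fun k => ⟨x k.1, hmem k⟩ with hemb
  have hinj : Function.Injective emb := by
    intro k l hkl
    have h1 : x k.1 = x l.1 := congrArg Subtype.val hkl
    exact Subtype.ext (hx h1)
  set s₀ : Finset {y : EuclideanSpace ℝ (Fin 3) // y ∈ P.points ∧ y ≠ x i} :=
    (Finset.univ.erase i).attach.image emb with hs₀
  have hsign : ∀ y ∉ s₀, 0 ≤ (fun b => -f b) y := by
    intro y hy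
    have hfar : ∀ j, y.1 ≠ x j := by
      intro j hj
      by_cases hji : j = i
      · exact y.2.2 (hji ▸ hj)
      · exact hy (Finset.mem_image.2 ⟨⟨j, Finset.mem_erase.2 ⟨hji, Finset.mem_univ j⟩⟩,
          Finset.mem_attach _ _, Subtype.ext hj.symm⟩)
    have h1 := two_le_dist_of_mem_points hPm hPl i y.2.1 hfar
    simp only [hf, neg_nonneg]
    exact lennardJones_nonpos (by linarith)
  have h1 := sum_le_hasSum s₀ hsign hsum.hasSum.neg
  have h2 : ∑ y ∈ s₀, f y = siteEnergy lennardJones x i := by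
    rw [hs₀, Finset.sum_image fun k _ l _ h => hinj h]
    exact Finset.sum_attach (Finset.univ.erase i) fun k => lennardJones (dist (x i) (x k))
  rw [Finset.sum_neg_distrib, h2] at h1
  linarith

/-- Hence `e(P) ≤ E_LJ(x)/N` (`N ≥ 1`, `x` injective, `#motif = N`, double counting
`2 E_LJ = Σᵢ site energies`). [folklore] -/
theorem energyPerParticle_le (hPm : P.motif = Finset.univ.image x)
    (hPl : ∀ g ∈ P.lattice, g ≠ 0 → 2 * ∑ k, ‖x k‖ + 2 ≤ ‖g‖) (hx : Function.Injective x)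
    (hN : 0 < N) :
    P.energyPerParticle lennardJones ≤ interactionEnergy lennardJones x / N := by
  have hcard : P.motif.card = N := by
    rw [hPm, Finset.card_image_of_injective _ hx, Finset.card_univ, Fintype.card_fin]
  have hNr : (0 : ℝ) < N := by exact_mod_cast hN
  unfold PeriodicConfiguration.energyPerParticle
  rw [hcard]
  have hsum : ∑ z ∈ P.motif,
      ∑' y : {y : EuclideanSpace ℝ (Fin 3) // y ∈ P.points ∧ y ≠ z}, lennardJones (dist z y.1) ≤
        ∑ i, siteEnergy lennardJones x i := by
    rw [hPm, Finset.sum_image fun i _ j _ h => hx h]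
    exact Finset.sum_le_sum fun i _ => tsum_le_siteEnergy hPm hPl hx i
  rw [← two_mul_interactionEnergy] at hsum
  calc (2 * (N : ℝ))⁻¹ * ∑ z ∈ P.motif,
        ∑' y : {y : EuclideanSpace ℝ (Fin 3) // y ∈ P.points ∧ y ≠ z}, lennardJones (dist z y.1)
      ≤ (2 * (N : ℝ))⁻¹ * (2 * interactionEnergy lennardJones x) :=
        mul_le_mul_of_nonneg_left hsum (by positivity)
    _ = interactionEnergy lennardJones x / N := by
        field_simp

end Consequences

/-- A `1/3`-separated configuration is injective (coincident points are at distance `0 < 1/3`).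
[folklore] -/
theorem injective_of_separated
    (hsep : ∀ i j : Fin N, i ≠ j → (1 / 3 : ℝ) ≤ dist (x i) (x j)) : Function.Injective x := by
  intro i j hij
  by_contra hne
  have h := hsep i j hne
  rw [hij, dist_self] at h
  norm_num at h

/-- Arithmetic of the transfer: from `e + g·D/N ≤ E/N` (`N > 0`) to `N·e + g·D ≤ E`. [folklore] -/
theorem mul_add_le_of_add_div_le {e D E N g : ℝ} (hN : 0 < N) (h : e + g * D / N ≤ E / N) :
    N * e + g * D ≤ E := by
  rw [le_div_iff₀ hN, add_mul, div_mul_cancel₀ _ hN.ne'] at h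
  linarith

end CoarseTierTransfer

open CoarseTierTransfer

/-- **S3t — transfer torus → finite for the far (coarse, `1/15`) tier** of line
`elastic-tier-overlap-split` (crux `ReggeStarCoercivity.StarCoercivity`, item 13600).
If some `g₁ > 0` charges every `1/15`-gross motif point of every `1/3`-separated periodic
configuration of `ℝ³` (`e_per + g₁ · #gross/#motif ≤ e(P)`, shells read in `P.points` within
radius `6/5`, recentred and rescaled by an admissible dilation `a ∈ [9/10, 11/10]`, matched to the
fcc or hcp kissing pattern), then the same `g₁` and the boundary constant `C = 0` give, for every
`1/3`-separated finite `x : Fin N → ℝ³`, `N · e_per + g₁ · #Def₁⁄₁₅(x) − 0 · N^(2/3) ≤ E_LJ(x)`.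
Proof: apply the hypothesis to a periodisation of `x` with periods `≥ 2Σ‖xᵢ‖ + 2` (separated,
shells unchanged, `#motif = N`, `e ≤ E_LJ(x)/N`) and multiply by `N`; `N = 0` is trivial.
[folklore] -/
theorem stub_coarseTierTransfer :
    (∃ g₁ : ℝ, 0 < g₁ ∧ ∀ P : Literature.MathematicalPhysics.StatisticalMechanics.PeriodicConfiguration 3,
      (∀ u ∈ P.points, ∀ v ∈ P.points, u ≠ v → (1 / 3 : ℝ) ≤ dist u v) →
      (⨅ Q : Literature.MathematicalPhysics.StatisticalMechanics.PeriodicConfiguration 3,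
          Q.energyPerParticle Literature.MathematicalPhysics.StatisticalMechanics.lennardJones)
        + g₁ * ((P.motif.filter fun s => ¬ ∃ a : ℝ, 9 / 10 ≤ a ∧ a ≤ 11 / 10 ∧
            (Literature.Geometry.DiscreteGeometry.ShellCloseTo (1 / 15)
                ((P.finite_inter_points (Metric.isBounded_closedBall.subset Set.sdiff_subset :
                  Bornology.IsBounded (Metric.closedBall s (6 / 5) \ {s}))).toFinset.image fun y => a⁻¹ • (y - s))
                Literature.Geometry.DiscreteGeometry.fccKissingPattern ∨
              Literature.Geometry.DiscreteGeometry.ShellCloseTo (1 / 15)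
                ((P.finite_inter_points (Metric.isBounded_closedBall.subset Set.sdiff_subset :
                  Bornology.IsBounded (Metric.closedBall s (6 / 5) \ {s}))).toFinset.image fun y => a⁻¹ • (y - s))
                Literature.Geometry.DiscreteGeometry.hcpKissingPattern)).card : ℝ)
          / (P.motif.card : ℝ)
        ≤ P.energyPerParticle Literature.MathematicalPhysics.StatisticalMechanics.lennardJones) →
    ∃ g₁ : ℝ, 0 < g₁ ∧ ∃ C : ℝ, ∀ (N : ℕ) (x : Fin N → EuclideanSpace ℝ (Fin 3)),
      (∀ i j : Fin N, i ≠ j → (1 / 3 : ℝ) ≤ dist (x i) (x j)) →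
      (N : ℝ) * (⨅ Q : PeriodicConfiguration 3, Q.energyPerParticle lennardJones)
          + g₁ * (Nat.card {i : Fin N // ¬ ∃ a : ℝ, 9 / 10 ≤ a ∧ a ≤ 11 / 10 ∧
              (ShellCloseTo (1 / 15) ((Finset.univ.filter fun j : Fin N => j ≠ i ∧ dist (x i) (x j) ≤ 6 / 5).image
                  fun j => a⁻¹ • (x j - x i)) fccKissingPattern ∨
                ShellCloseTo (1 / 15) ((Finset.univ.filter fun j : Fin N => j ≠ i ∧ dist (x i) (x j) ≤ 6 / 5).image
                  fun j => a⁻¹ • (x j - x i)) hcpKissingPattern)} : ℝ)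
          - C * (N : ℝ) ^ (2 / 3 : ℝ) ≤ interactionEnergy lennardJones x := by
  rintro ⟨g₁, hg₁, hP⟩
  refine ⟨g₁, hg₁, 0, fun N x hsep => ?_⟩
  simp only [zero_mul, sub_zero]
  rcases Nat.eq_zero_or_pos N with rfl | hN
  · simp [interactionEnergy]
  · have hx : Function.Injective x := injective_of_separated hsep
    obtain ⟨P, hPm, hPl⟩ := exists_periodicConfiguration x hN
    have key := hP P (separated_points hPm hPl hsep)
    have hcardm : (P.motif.card : ℝ) = N := by
      rw [hPm, Finset.card_image_of_injective _ hx]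
      simp
    rw [card_gross_motif hPm hPl hx (1 / 15), hcardm] at key
    have h2 := energyPerParticle_le hPm hPl hx hN
    have hNr : (0 : ℝ) < N := by exact_mod_cast hN
    exact mul_add_le_of_add_div_le hNr (key.trans h2)

end Summit.AtomisticToContinuum.Crystallization.Theorems

end
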